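import Literature.MathematicalPhysics.KineticTheory.BoltzmannSolutionsUkaiVelocity
import HarnessLib

/-!
# Ukai–Lanford local well-posedness of the hard-sphere Boltzmann equation, II: time integrals in the scale `X_{β(t)}`, an ODE comparison lemma, Lanford norms

Helper file (theorems only) for the discharge of the named fact
`Literature.MathematicalPhysics.KineticTheory.ukai_lanford_lwp`. Contents:

* `abs_integral_le_of_scale` — **Ukai's time-integral estimate** (GST 2013, Part II Ch. 5,
  Lemma "Ukai" and Remark 5.? on the strategy: the supremum of a time integral, not the time
  integral of a supremum): if `|q(s)| ≤ A (1 + r) e^{-β(s) r²/2}` on `(t₁, t)` for the linearly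
  decreasing weight `β(s) = β₁ - λ (s - t₁)`, then
  `|∫_{t₁}^t q| ≤ A e^{-β(t) r²/2} ((t - t₁) + 2 √(t - t₁) / √(2λ))`: the factor `1 + r`
  (hard-sphere loss of weight) is absorbed by `(1 + r) e^{-λ (t-s) r²/2} ≤ 1 + (2λ(t-s))^{-1/2}`,
  an integrable singularity;
* `ge_neg_integral_of_duhamel_ineq` — the elementary comparison lemma behind positivity of mild
  solutions: if `φ(t) = φ(0) + ∫₀ᵗ q`, `q + ℓ φ ≥ -r` with `ℓ, r ≥ 0` continuous and `φ(0) ≥ 0`,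
  then `φ(t) ≥ -∫₀ᵗ r` (integrating factor `e^{∫ℓ}`, `monotoneOn_of_deriv_nonneg`);
* Lanford's weighted sup norm `Literature.Analysis.FluidPDE.eGaussSupNorm`: explicit bounds in
  both directions (`eGaussSupNorm_le_ofReal`, `abs_le_of_eGaussSupNorm_le`), the triangle
  inequality, membership in Lanford's class from a pointwise Gaussian bound
  (`memLanford_of_bound`), a uniform pointwise bound on `[0, T]` for
  `Literature.Analysis.FluidPDE.ContinuousInLanfordOn` families (`exists_bound_of_continuousInLanfordOn`,
  compactness of `[0, T]` in `ℝ≥0∞`-valued continuity), and continuity in time in `X_{β'}` of a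
  jointly continuous family bounded in `X_{β₁}`, `β₁ > β'` (`tendsto_eGaussSupNorm_sub`:
  Heine–Cantor on `[0,T] × X × B_R` plus the Gaussian tail).

No definitions, no named facts.

## References

* I. Gallagher, L. Saint-Raymond, B. Texier, *From Newton to Boltzmann: hard spheres and
  short-range potentials*, ZLAM, EMS (2013), arXiv:1208.5753: Part II Ch. 5 §§1–4.
* S. Ukai, *The Boltzmann–Grad limit and Cauchy–Kovalevskaya theorem*, Japan J. Indust. Appl.
  Math. 18 (2001) 383–392.
-/

open MeasureTheory Metric Real Set Filter Topology
open scoped InnerProductSpace ENNReal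

namespace Literature.MathematicalPhysics.KineticTheory

namespace UkaiLanford

noncomputable section

/-! ## Ukai's time-integral estimate in the scale `β(s) = β₁ - λ (s - t₁)` -/

section Scale

/-- `∫_{t₁}^t (t - s)^{-1/2} ds = 2 √(t - t₁)`. [folklore] -/
theorem integral_rpow_neg_half_sub (t₁ t : ℝ) :
    ∫ s in t₁..t, (t - s) ^ (-(1 / 2 : ℝ)) = 2 * sqrt (t - t₁) := by
  rw [intervalIntegral.integral_comp_sub_left (fun u => u ^ (-(1 / 2 : ℝ))) t, sub_self,
    integral_rpow (Or.inl (by norm_num))]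
  have h1 : (-(1 / 2 : ℝ) + 1) = 1 / 2 := by norm_num
  rw [h1, Real.zero_rpow (by norm_num), sub_zero, ← Real.sqrt_eq_rpow (t - t₁)]
  ring

/-- **Ukai's time-integral estimate in the scale `X_{β(s)}`** (GST 2013, Part II Ch. 5, Lemma
"Ukai"; Ukai 2001): let `λ > 0`, `t₁ ≤ t`, and suppose `|q(s)| ≤ A (1 + r) e^{-β(s) r²/2}` for
`s ∈ (t₁, t)`, where `β(s) = β₁ - λ (s - t₁)`. Then
`|∫_{t₁}^t q(s) ds| ≤ A e^{-β(t) r²/2} ((t - t₁) + 2 √(t - t₁) / √(2λ))`. (No integrability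
of `q` is needed: a non-integrable `q` has integral `0`.) [cite: GST2013, Part II Ch. 5 §3 (Lemma of Ukai)] -/
theorem abs_integral_le_of_scale {q : ℝ → ℝ} {A lam β₁ t₁ t r : ℝ} (hA : 0 ≤ A) (hlam : 0 < lam)
    (ht : t₁ ≤ t)
    (hq : ∀ s ∈ Ioo t₁ t, |q s| ≤ A * ((1 + r) * exp (-((β₁ - lam * (s - t₁)) / 2) * r ^ 2))) :
    |∫ s in t₁..t, q s| ≤
      A * exp (-((β₁ - lam * (t - t₁)) / 2) * r ^ 2) *
        ((t - t₁) + 2 * sqrt (t - t₁) / sqrt (2 * lam)) := by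
  set et := exp (-((β₁ - lam * (t - t₁)) / 2) * r ^ 2) with het
  have het0 : 0 ≤ A * et := mul_nonneg hA (exp_pos _).le
  set g : ℝ → ℝ := fun s => A * et * (1 + (2 * lam) ^ (-(1 / 2 : ℝ)) * (t - s) ^ (-(1 / 2 : ℝ)))
    with hg
  -- pointwise domination on the open interval
  have hpt : ∀ s ∈ Ioo t₁ t, |q s| ≤ g s := by
    intro s hs
    have hts : 0 < t - s := sub_pos.2 hs.2
    have hδ : 0 < lam * (t - s) := mul_pos hlam hts
    have hsplit : exp (-((β₁ - lam * (s - t₁)) / 2) * r ^ 2) =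
        et * exp (-(lam * (t - s) / 2) * r ^ 2) := by
      rw [het, ← Real.exp_add]; congr 1; ring
    have hw := one_add_mul_exp_le hδ r
    have hconv : 1 / sqrt (2 * (lam * (t - s))) =
        (2 * lam) ^ (-(1 / 2 : ℝ)) * (t - s) ^ (-(1 / 2 : ℝ)) := by
      rw [show 2 * (lam * (t - s)) = (2 * lam) * (t - s) by ring, Real.sqrt_eq_rpow, one_div,
        ← Real.rpow_neg (by positivity), Real.mul_rpow (by positivity) hts.le]
    calc |q s| ≤ A * ((1 + r) * exp (-((β₁ - lam * (s - t₁)) / 2) * r ^ 2)) := hq s hs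
      _ = A * et * ((1 + r) * exp (-(lam * (t - s) / 2) * r ^ 2)) := by rw [hsplit]; ring
      _ ≤ A * et * (1 + 1 / sqrt (2 * (lam * (t - s)))) := mul_le_mul_of_nonneg_left hw het0
      _ = g s := by rw [hg, hconv]
  -- integrability of the dominating function
  have h1 : IntervalIntegrable (fun s => (t - s) ^ (-(1 / 2 : ℝ))) volume t₁ t := by
    have h := (intervalIntegral.intervalIntegrable_rpow' (a := t - t₁) (b := 0)
      (by norm_num : (-1 : ℝ) < -(1 / 2))).comp_sub_left t
    simpa using h
  have hgi : IntervalIntegrable g volume t₁ t :=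
    (intervalIntegrable_const.add (h1.const_mul ((2 * lam) ^ (-(1 / 2 : ℝ))))).const_mul (A * et)
  -- the bound
  have hne : ∀ᵐ s ∂(volume : Measure ℝ), s ≠ t := by simp [ae_iff]
  have hae : ∀ᵐ s ∂(volume : Measure ℝ), s ∈ Ioc t₁ t → ‖q s‖ ≤ g s := by
    filter_upwards [hne] with s hs hmem
    rw [Real.norm_eq_abs]
    exact hpt s ⟨hmem.1, lt_of_le_of_ne hmem.2 hs⟩
  have hmain := intervalIntegral.norm_integral_le_of_norm_le ht hae hgi
  rw [Real.norm_eq_abs] at hmain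
  refine hmain.trans (le_of_eq ?_)
  have hI1 : ∫ s in t₁..t, (t - s) ^ (-(1 / 2 : ℝ)) = 2 * sqrt (t - t₁) := integral_rpow_neg_half_sub t₁ t
  calc ∫ s in t₁..t, g s
      = A * et * ((t - t₁) + (2 * lam) ^ (-(1 / 2 : ℝ)) * (2 * sqrt (t - t₁))) := by
        rw [hg, intervalIntegral.integral_const_mul,
          intervalIntegral.integral_add intervalIntegrable_const (h1.const_mul _),
          intervalIntegral.integral_const, intervalIntegral.integral_const_mul, hI1, smul_eq_mul, mul_one]
    _ = A * et * ((t - t₁) + 2 * sqrt (t - t₁) / sqrt (2 * lam)) := by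
        rw [Real.sqrt_eq_rpow (2 * lam), Real.rpow_neg (by positivity)]; ring

end Scale

/-! ## An ODE comparison lemma (integrating factor) -/

section Comparison

/-- **Comparison lemma behind positivity of mild solutions.** Let `φ(t) = φ(0) + ∫₀ᵗ q(s) ds` on
`[0, T]` with `q` continuous, and suppose `q + ℓ φ ≥ -r` on `[0, T]` for continuous `ℓ ≥ 0`,
`r ≥ 0`. If `φ(0) ≥ 0` then `φ(t) ≥ -∫₀ᵗ r` on `[0, T]`. Proof: `ψ = e^{Λ} φ + ∫₀ e^{Λ} r`,
`Λ = ∫₀ ℓ`, has `ψ' = e^{Λ}(q + ℓ φ + r) ≥ 0`, hence `e^{Λ(t)} φ(t) ≥ -∫₀ᵗ e^{Λ} r ≥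
-e^{Λ(t)} ∫₀ᵗ r`. (The Kaniel–Shinbrot sign structure `Q = Q⁺ - f L(f)` feeds this with
`ℓ = L(f⁺)`.) [folklore] -/
theorem ge_neg_integral_of_duhamel_ineq {φ q ℓ r : ℝ → ℝ} {T : ℝ}
    (hq : Continuous q) (hℓ : Continuous ℓ) (hr : Continuous r)
    (hℓ0 : ∀ s, 0 ≤ ℓ s) (hr0 : ∀ s, 0 ≤ r s)
    (hφ : ∀ t ∈ Icc 0 T, φ t = φ 0 + ∫ s in (0 : ℝ)..t, q s)
    (hsrc : ∀ s ∈ Icc 0 T, -r s ≤ q s + ℓ s * φ s) (h0 : 0 ≤ φ 0) :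
    ∀ t ∈ Icc 0 T, -(∫ s in (0 : ℝ)..t, r s) ≤ φ t := by
  intro t ht
  -- primitives
  set Φ : ℝ → ℝ := fun u => φ 0 + ∫ s in (0 : ℝ)..u, q s with hΦ
  set Λ : ℝ → ℝ := fun u => ∫ s in (0 : ℝ)..u, ℓ s with hΛ
  have hΛc : Continuous Λ :=
    intervalIntegral.continuous_primitive (fun a b => hℓ.intervalIntegrable a b) 0
  have hRi : Continuous (fun s => exp (Λ s) * r s) := (continuous_exp.comp hΛc).mul hr
  set R : ℝ → ℝ := fun u => ∫ s in (0 : ℝ)..u, exp (Λ s) * r s with hR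
  set Ψ : ℝ → ℝ := fun u => exp (Λ u) * Φ u + R u with hΨ
  -- derivatives
  have hdΦ : ∀ u, HasDerivAt Φ (q u) u := fun u =>
    ((hq.integral_hasStrictDerivAt 0 u).hasDerivAt).const_add (φ 0)
  have hdΛ : ∀ u, HasDerivAt Λ (ℓ u) u := fun u => (hℓ.integral_hasStrictDerivAt 0 u).hasDerivAt
  have hdR : ∀ u, HasDerivAt R (exp (Λ u) * r u) u := fun u =>
    (hRi.integral_hasStrictDerivAt 0 u).hasDerivAt
  have hdΨ : ∀ u, HasDerivAt Ψ (exp (Λ u) * (q u + ℓ u * Φ u + r u)) u := fun u => by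
    have h1 : HasDerivAt (fun u => exp (Λ u)) (exp (Λ u) * ℓ u) u := (hdΛ u).exp
    have h2 : HasDerivAt (fun u => exp (Λ u) * Φ u + R u)
        (exp (Λ u) * ℓ u * Φ u + exp (Λ u) * q u + exp (Λ u) * r u) u := (h1.mul (hdΦ u)).add (hdR u)
    exact h2.congr_deriv (by ring)
  have hΨd : Differentiable ℝ Ψ := fun u => (hdΨ u).differentiableAt
  have hΨc : Continuous Ψ := hΨd.continuous
  -- `Ψ` is monotone on `[0, T]`
  have hmono : MonotoneOn Ψ (Icc 0 T) := by
    refine monotoneOn_of_deriv_nonneg (convex_Icc 0 T) hΨc.continuousOn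
      (fun u _ => (hdΨ u).differentiableAt.differentiableWithinAt) fun u hu => ?_
    rw [interior_Icc] at hu
    have hu' : u ∈ Icc 0 T := Ioo_subset_Icc_self hu
    rw [(hdΨ u).deriv]
    have hΦu : Φ u = φ u := (hφ u hu').symm
    rw [hΦu]
    have := hsrc u hu'
    exact mul_nonneg (exp_pos _).le (by linarith)
  have h0T : (0 : ℝ) ∈ Icc 0 T := ⟨le_refl _, ht.1.trans ht.2⟩
  have hΨ0 : Ψ 0 = φ 0 := by simp [hΨ, hΦ, hΛ, hR]
  have hle : Ψ 0 ≤ Ψ t := hmono h0T ht ht.1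
  have hΦt : Φ t = φ t := (hφ t ht).symm
  -- `R t ≤ e^{Λ t} ∫₀ᵗ r`
  have hRle : R t ≤ exp (Λ t) * ∫ s in (0 : ℝ)..t, r s := by
    rw [hR, ← intervalIntegral.integral_const_mul]
    refine intervalIntegral.integral_mono_on ht.1 (hRi.intervalIntegrable 0 t)
      ((continuous_const.mul hr).intervalIntegrable 0 t) fun s hs => ?_
    have hΛst : Λ s ≤ Λ t := by
      have hsub : (∫ u in (0 : ℝ)..t, ℓ u) - ∫ u in (0 : ℝ)..s, ℓ u = ∫ u in s..t, ℓ u :=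
        intervalIntegral.integral_interval_sub_left (hℓ.intervalIntegrable 0 t)
          (hℓ.intervalIntegrable 0 s)
      have hnn : 0 ≤ ∫ u in s..t, ℓ u := intervalIntegral.integral_nonneg hs.2 fun u _ => hℓ0 u
      have : Λ t - Λ s = ∫ u in s..t, ℓ u := by rw [hΛ]; exact hsub
      linarith
    exact mul_le_mul_of_nonneg_right (exp_le_exp.2 hΛst) (hr0 s)
  -- conclude
  have hΨt : Ψ t = exp (Λ t) * φ t + R t := by rw [hΨ]; simp only []; rw [hΦt]
  have hkey : exp (Λ t) * (-(∫ s in (0 : ℝ)..t, r s)) ≤ exp (Λ t) * φ t := by linarith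
  exact le_of_mul_le_mul_left hkey (exp_pos _)

end Comparison

/-! ## Lanford's weighted sup norms -/

section LanfordNorm

variable {E : Type*} [NormedAddCommGroup E] {X : Type*}

/-- An explicit upper bound for Lanford's weighted sup norm: if `e^{β|v|²/2} |g(x, v)| ≤ C`
pointwise then `‖g‖_β ≤ C`. [folklore] -/
theorem eGaussSupNorm_le_ofReal {β C : ℝ} {g : X → E → ℝ}
    (h : ∀ x v, exp (β / 2 * ‖v‖ ^ 2) * |g x v| ≤ C) :
    Literature.Analysis.FluidPDE.eGaussSupNorm β g ≤ ENNReal.ofReal C := by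
  rw [Literature.Analysis.FluidPDE.eGaussSupNorm]
  refine iSup_le fun x => iSup_le fun v => ?_
  rw [Real.enorm_eq_ofReal_abs, ← ENNReal.ofReal_mul (exp_pos _).le]
  exact ENNReal.ofReal_le_ofReal (h x v)

/-- The pointwise Gaussian bound encoded by `‖g‖_β ≤ C`: `|g(x, v)| ≤ C e^{-β|v|²/2}`. [folklore] -/
theorem abs_le_of_eGaussSupNorm_le {β C : ℝ} {g : X → E → ℝ} (hC : 0 ≤ C)
    (h : Literature.Analysis.FluidPDE.eGaussSupNorm β g ≤ ENNReal.ofReal C) (x : X) (v : E) :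
    |g x v| ≤ C * exp (-(β / 2) * ‖v‖ ^ 2) := by
  have h1 := (Literature.Analysis.FluidPDE.enorm_le_eGaussSupNorm β g x v).trans h
  rw [Real.enorm_eq_ofReal_abs, ← ENNReal.ofReal_mul (exp_pos _).le,
    ENNReal.ofReal_le_ofReal_iff hC] at h1
  have h3 : exp (-(β / 2) * ‖v‖ ^ 2) * exp (β / 2 * ‖v‖ ^ 2) = 1 := by
    rw [← Real.exp_add, show -(β / 2) * ‖v‖ ^ 2 + β / 2 * ‖v‖ ^ 2 = 0 by ring, exp_zero]
  calc |g x v| = exp (-(β / 2) * ‖v‖ ^ 2) * (exp (β / 2 * ‖v‖ ^ 2) * |g x v|) := by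
        rw [← mul_assoc, h3, one_mul]
    _ ≤ exp (-(β / 2) * ‖v‖ ^ 2) * C := mul_le_mul_of_nonneg_left h1 (exp_pos _).le
    _ = C * exp (-(β / 2) * ‖v‖ ^ 2) := mul_comm _ _

/-- Triangle inequality for Lanford's weighted sup norm. [folklore] -/
theorem eGaussSupNorm_add_le (β : ℝ) (g h : X → E → ℝ) :
    Literature.Analysis.FluidPDE.eGaussSupNorm β (g + h) ≤
      Literature.Analysis.FluidPDE.eGaussSupNorm β g + Literature.Analysis.FluidPDE.eGaussSupNorm β h := by
  rw [Literature.Analysis.FluidPDE.eGaussSupNorm]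
  refine iSup_le fun x => iSup_le fun v => ?_
  calc ENNReal.ofReal (exp (β / 2 * ‖v‖ ^ 2)) * ‖(g + h) x v‖ₑ
      ≤ ENNReal.ofReal (exp (β / 2 * ‖v‖ ^ 2)) * (‖g x v‖ₑ + ‖h x v‖ₑ) := by
        gcongr; exact enorm_add_le _ _
    _ = ENNReal.ofReal (exp (β / 2 * ‖v‖ ^ 2)) * ‖g x v‖ₑ +
          ENNReal.ofReal (exp (β / 2 * ‖v‖ ^ 2)) * ‖h x v‖ₑ := mul_add _ _ _
    _ ≤ _ := add_le_add (Literature.Analysis.FluidPDE.enorm_le_eGaussSupNorm β g x v)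
          (Literature.Analysis.FluidPDE.enorm_le_eGaussSupNorm β h x v)

/-- The weighted sup norm is invariant under `g ↦ -g`. [folklore] -/
theorem eGaussSupNorm_neg (β : ℝ) (g : X → E → ℝ) :
    Literature.Analysis.FluidPDE.eGaussSupNorm β (-g) = Literature.Analysis.FluidPDE.eGaussSupNorm β g := by
  simp only [Literature.Analysis.FluidPDE.eGaussSupNorm, Pi.neg_apply, enorm_neg]

/-- `‖g - h‖_β = ‖h - g‖_β`. [folklore] -/
theorem eGaussSupNorm_sub_comm (β : ℝ) (g h : X → E → ℝ) :
    Literature.Analysis.FluidPDE.eGaussSupNorm β (g - h) = Literature.Analysis.FluidPDE.eGaussSupNorm β (h - g) := by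
  rw [← neg_sub, eGaussSupNorm_neg]

/-- Membership in Lanford's class `X_β` from joint continuity and a pointwise Gaussian bound with
a larger or equal inverse temperature `β₁ ≥ β`. [folklore] -/
theorem memLanford_of_bound [TopologicalSpace X] {β β₁ C : ℝ} {g : X → E → ℝ} (hβ : β ≤ β₁)
    (hC : 0 ≤ C) (hcont : Continuous (Function.uncurry g))
    (hb : ∀ x v, |g x v| ≤ C * exp (-(β₁ / 2) * ‖v‖ ^ 2)) :
    Literature.Analysis.FluidPDE.MemLanford β g := by
  refine ⟨hcont, lt_of_le_of_lt (eGaussSupNorm_le_ofReal (C := C) fun x v => ?_) ENNReal.ofReal_lt_top⟩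
  have h1 : exp (-((β₁ - β) / 2) * ‖v‖ ^ 2) ≤ 1 := by
    rw [exp_le_one_iff]; nlinarith [sq_nonneg ‖v‖]
  calc exp (β / 2 * ‖v‖ ^ 2) * |g x v|
      ≤ exp (β / 2 * ‖v‖ ^ 2) * (C * exp (-(β₁ / 2) * ‖v‖ ^ 2)) :=
        mul_le_mul_of_nonneg_left (hb x v) (exp_pos _).le
    _ = C * exp (-((β₁ - β) / 2) * ‖v‖ ^ 2) := by
        rw [mul_left_comm, ← Real.exp_add]; congr 1; congr 1; ring
    _ ≤ C * 1 := mul_le_mul_of_nonneg_left h1 hC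
    _ = C := mul_one C

/-- **A uniform Gaussian bound on `[0, T]` for time-continuous Lanford families**: if
`f ∈ C([0, T]; X_β)` (`Literature.Analysis.FluidPDE.ContinuousInLanfordOn`) then there is
`M ≥ 0` with `|f(t, x, v)| ≤ M e^{-β|v|²/2}` for all `t ∈ [0, T]` (continuity of
`t ↦ ‖f(t)‖_β ∈ ℝ≥0∞` on the compact interval). [folklore] -/
theorem exists_bound_of_continuousInLanfordOn [TopologicalSpace X] {β T : ℝ}
    {f : ℝ → X → E → ℝ} (hf : Literature.Analysis.FluidPDE.ContinuousInLanfordOn (Icc 0 T) β f) :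
    ∃ M : ℝ, 0 ≤ M ∧ ∀ t ∈ Icc 0 T, ∀ x v, |f t x v| ≤ M * exp (-(β / 2) * ‖v‖ ^ 2) := by
  rcases lt_or_ge T 0 with hT | hT
  · exact ⟨0, le_refl _, fun t ht => absurd (ht.1.trans ht.2) (not_le.2 hT)⟩
  set n : ℝ → ℝ≥0∞ := fun t => Literature.Analysis.FluidPDE.eGaussSupNorm β (f t) with hn
  have hcont : ContinuousOn n (Icc 0 T) := by
    intro t₀ ht₀
    have he := hf.2 t₀ ht₀
    have hfin : n t₀ ≠ ∞ := (hf.1 t₀ ht₀).2.ne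
    have hup : ∀ t, n t ≤ n t₀ + Literature.Analysis.FluidPDE.eGaussSupNorm β (f t - f t₀) := fun t => by
      have hft : f t = f t₀ + (f t - f t₀) := by abel
      calc n t = Literature.Analysis.FluidPDE.eGaussSupNorm β (f t₀ + (f t - f t₀)) := by
            rw [hn]; exact congrArg _ hft
        _ ≤ _ := eGaussSupNorm_add_le _ _ _
    have hlow : ∀ t, n t₀ ≤ n t + Literature.Analysis.FluidPDE.eGaussSupNorm β (f t - f t₀) := fun t => by
      have hft : f t₀ = f t + (f t₀ - f t) := by abel
      calc n t₀ = Literature.Analysis.FluidPDE.eGaussSupNorm β (f t + (f t₀ - f t)) := by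
            rw [hn]; exact congrArg _ hft
        _ ≤ n t + Literature.Analysis.FluidPDE.eGaussSupNorm β (f t₀ - f t) := eGaussSupNorm_add_le _ _ _
        _ = n t + Literature.Analysis.FluidPDE.eGaussSupNorm β (f t - f t₀) := by rw [eGaussSupNorm_sub_comm]
    have h1 : Tendsto (fun t => n t₀ - Literature.Analysis.FluidPDE.eGaussSupNorm β (f t - f t₀))
        (𝓝[Icc 0 T] t₀) (𝓝 (n t₀)) := by
      have := ENNReal.Tendsto.sub (tendsto_const_nhds (x := n t₀)) he (Or.inl hfin)
      simpa using this
    have h2 : Tendsto (fun t => n t₀ + Literature.Analysis.FluidPDE.eGaussSupNorm β (f t - f t₀))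
        (𝓝[Icc 0 T] t₀) (𝓝 (n t₀)) := by
      have := (tendsto_const_nhds (x := n t₀)).add he
      simpa using this
    exact tendsto_of_tendsto_of_tendsto_of_le_of_le' h1 h2
      (Eventually.of_forall fun t => tsub_le_iff_right.2 (hlow t)) (Eventually.of_forall hup)
  obtain ⟨t₁, ht₁, hmax⟩ := isCompact_Icc.exists_isMaxOn ⟨0, le_refl _, hT⟩ hcont
  have hfin : n t₁ ≠ ∞ := (hf.1 t₁ ht₁).2.ne
  refine ⟨(n t₁).toReal, ENNReal.toReal_nonneg, fun t ht x v => ?_⟩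
  have hle : Literature.Analysis.FluidPDE.eGaussSupNorm β (f t) ≤ ENNReal.ofReal (n t₁).toReal := by
    rw [ENNReal.ofReal_toReal hfin]; exact hmax ht
  exact abs_le_of_eGaussSupNorm_le ENNReal.toReal_nonneg hle x v

/-- **Continuity in time in `X_{β'}` from joint continuity and a bound in `X_{β₁}`, `β₁ > β'`**
(why GST's classes `X_{β(t)}`, `β` decreasing, embed in `C([0,T]; X_{β'})`): for a jointly
continuous `F : ℝ × X × E → ℝ` on a compact metric position space `X` and a proper velocity
space `E` with `|F(t, x, v)| ≤ C e^{-β₁|v|²/2}` on `[0, T]`, and `0 ≤ β' < β₁`,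
`‖F(t) - F(t₀)‖_{β'} → 0` as `t → t₀` within `[0, T]` (Heine–Cantor on `[0,T] × X × B_R`
for `|v| ≤ R`, the Gaussian tail `2C e^{-(β₁-β')R²/2}` for `|v| > R`). [folklore] -/
theorem tendsto_eGaussSupNorm_sub {Y : Type*} [PseudoMetricSpace Y] [CompactSpace Y]
    [ProperSpace E] {F : ℝ → Y → E → ℝ} (hF : Continuous fun p : ℝ × Y × E => F p.1 p.2.1 p.2.2)
    {T β₁ β' C : ℝ} (hββ : β' < β₁) (hβ' : 0 ≤ β') (hC : 0 ≤ C)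
    (hb : ∀ t ∈ Icc 0 T, ∀ x v, |F t x v| ≤ C * exp (-(β₁ / 2) * ‖v‖ ^ 2)) :
    ∀ t₀ ∈ Icc 0 T, Tendsto (fun t => Literature.Analysis.FluidPDE.eGaussSupNorm β' (F t - F t₀))
      (𝓝[Icc 0 T] t₀) (𝓝 0) := by
  intro t₀ ht₀
  rw [ENNReal.tendsto_nhds_zero]
  intro ε hε
  rcases eq_or_ne ε ∞ with hεtop | hεtop
  · exact Eventually.of_forall fun t => hεtop ▸ le_top
  set ε' := ε.toReal with hε'
  have hε'pos : 0 < ε' := ENNReal.toReal_pos hε.ne' hεtop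
  set δβ := β₁ - β' with hδβ
  have hδβ0 : 0 < δβ := sub_pos.2 hββ
  -- the Gaussian tail: choose `R`
  have hlim : Tendsto (fun R : ℝ => 2 * C * exp (-(δβ / 2) * R ^ 2)) atTop (𝓝 0) := by
    have h1 : Tendsto (fun R : ℝ => -(δβ / 2) * R ^ 2) atTop atBot :=
      (tendsto_pow_atTop two_ne_zero).const_mul_atTop_of_neg (by linarith : -(δβ / 2) < 0)
    have h2 := (Real.tendsto_exp_atBot.comp h1).const_mul (2 * C)
    simpa using h2
  obtain ⟨R, hR, hR1⟩ :=
    ((hlim.eventually_lt_const (half_pos hε'pos)).and (eventually_ge_atTop 1)).exists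
  -- uniform continuity on the compact `[0, T] × Y × B_R`
  set K : Set (ℝ × Y × E) := Icc 0 T ×ˢ (univ ×ˢ closedBall (0 : E) R) with hK
  have hKc : IsCompact K := isCompact_Icc.prod (isCompact_univ.prod (isCompact_closedBall 0 R))
  have huc := hKc.uniformContinuousOn_of_continuous hF.continuousOn
  rw [Metric.uniformContinuousOn_iff_le] at huc
  set η := ε' / 2 * exp (-(β' / 2) * R ^ 2) with hη
  have hηpos : 0 < η := by positivity
  obtain ⟨δ, hδ, hδF⟩ := huc η hηpos
  have hev : ∀ᶠ t in 𝓝[Icc 0 T] t₀, t ∈ Icc 0 T ∧ dist t t₀ ≤ δ :=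
    eventually_mem_nhdsWithin.and (mem_nhdsWithin_of_mem_nhds (Metric.closedBall_mem_nhds t₀ hδ))
  filter_upwards [hev] with t ht
  rw [← ENNReal.ofReal_toReal hεtop]
  refine eGaussSupNorm_le_ofReal fun x v => ?_
  rw [Pi.sub_apply, Pi.sub_apply]
  by_cases hv : ‖v‖ ≤ R
  · -- Heine–Cantor on the compact set
    have hp : (t, x, v) ∈ K := ⟨ht.1, mem_univ _, mem_closedBall_zero_iff.2 hv⟩
    have hp₀ : (t₀, x, v) ∈ K := ⟨ht₀, mem_univ _, mem_closedBall_zero_iff.2 hv⟩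
    have hdist : dist (t, x, v) (t₀, x, v) ≤ δ := by
      rw [Prod.dist_eq, Prod.dist_eq, dist_self, dist_self, max_self, max_eq_left dist_nonneg]
      exact ht.2
    have hclose := hδF _ hp _ hp₀ hdist
    rw [Real.dist_eq] at hclose
    have hexp : exp (β' / 2 * ‖v‖ ^ 2) ≤ exp (β' / 2 * R ^ 2) := by
      rw [exp_le_exp]
      exact mul_le_mul_of_nonneg_left (pow_le_pow_left₀ (norm_nonneg v) hv 2) (by linarith)
    calc exp (β' / 2 * ‖v‖ ^ 2) * |F t x v - F t₀ x v| ≤ exp (β' / 2 * R ^ 2) * η :=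
          mul_le_mul hexp hclose (abs_nonneg _) (exp_pos _).le
      _ = ε' / 2 * (exp (β' / 2 * R ^ 2) * exp (-(β' / 2) * R ^ 2)) := by rw [hη]; ring
      _ = ε' / 2 := by
          rw [← Real.exp_add, show β' / 2 * R ^ 2 + -(β' / 2) * R ^ 2 = 0 by ring, exp_zero, mul_one]
      _ ≤ ε' := by linarith
  · -- the Gaussian tail
    have hv' : R ≤ ‖v‖ := (not_le.1 hv).le
    have hR0 : 0 ≤ R := by linarith
    have h1 : |F t x v - F t₀ x v| ≤ 2 * C * exp (-(β₁ / 2) * ‖v‖ ^ 2) := by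
      have := abs_sub (F t x v) (F t₀ x v)
      have h2 := hb t ht.1 x v
      have h3 := hb t₀ ht₀ x v
      linarith
    have hsq : R ^ 2 ≤ ‖v‖ ^ 2 := pow_le_pow_left₀ hR0 hv' 2
    calc exp (β' / 2 * ‖v‖ ^ 2) * |F t x v - F t₀ x v|
        ≤ exp (β' / 2 * ‖v‖ ^ 2) * (2 * C * exp (-(β₁ / 2) * ‖v‖ ^ 2)) :=
          mul_le_mul_of_nonneg_left h1 (exp_pos _).le
      _ = 2 * C * exp (-(δβ / 2) * ‖v‖ ^ 2) := by
          rw [mul_left_comm, ← Real.exp_add]; congr 1; congr 1; rw [hδβ]; ring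
      _ ≤ 2 * C * exp (-(δβ / 2) * R ^ 2) := by
          refine mul_le_mul_of_nonneg_left (exp_le_exp.2 ?_) (by positivity)
          nlinarith
      _ ≤ ε' / 2 := hR.le
      _ ≤ ε' := by linarith

end LanfordNorm

end

end UkaiLanford

end Literature.MathematicalPhysics.KineticTheory
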